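import Summits.BirchSwinnertonDyer.BirchSwinnertonDyer.Theses.SignedBalanceX9
import Summits.BirchSwinnertonDyer.BirchSwinnertonDyer.Theorems.SignedBalanceX9Assembly
import HarnessLib

/-!
# Route `SignedBalanceX9` — `AssemblyViaUpperCoprime` (the one-sided separation at a COPRIME frame), kernel-checked

`Summit.BirchSwinnertonDyer.BirchSwinnertonDyer.Theses.SignedBalanceX9.AssemblyViaUpperCoprime` :=
`FourTermDefectUpperCoprimeX9 → AnalyticMuZeroX9 → TwistedAnalyticMuZeroCoprimeX9 → PublishedInputsX9 →
IntegralMainConjectureOnClassX9` is PROVED (LINE 7 «coprime class-number frames», ideator seat bsd-idea-2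
g3).  Exactly as `SignedBalanceUpper.signedBalanceX9_assemblyViaUpper` (Theorems/SignedBalanceX9AssemblyViaUpper):
at an X9 pair BCS 2025 Thm 1.1.2 (a) (first conjunct of `PublishedInputsX9`) gives `ch X = (g)`,
`ι g = p^k · L_p(f, α)`, `k ∈ ℤ`; SIGN (`SignedBalance.defect_nonneg_of_unit_coeff`): a unit coefficient
forces `0 ≤ k_i` at each of the four curves; the coprime supply gives a BCS-admissible `(d_K, d_F)` WITH
`p ∤ h(ℚ(√d_K))` whose three twists carry unit coefficients (they are X9 again,
`SignedBalance.twist_data`); the one-sided inequality AT COPRIME FRAMES (`FourTermDefectUpperCoprimeX9`,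
fed the class-number clause) gives `k + k₁ + k₂ + k₃ ≤ 0`; hence `k = 0`: the exact generator.

THEOREMS ONLY (no definition, no named fact, no `sorry`); nothing booked — the inequality, the two
analytic `μ = 0` supplies and the published inputs are hypotheses; no summit or leaf is proved; BSD is
not proved.
-/


set_option linter.dupNamespace false
set_option autoImplicit false

noncomputable section

open scoped Classical

open WeierstrassCurve Literature.NumberTheory.EllipticCurves Literature.NumberTheory.EllipticCurves.ModularForms
  Summit.BirchSwinnertonDyer.BirchSwinnertonDyer.Rank1Residual

open Summit.BirchSwinnertonDyer.BirchSwinnertonDyer.Theses.SignedBalanceX9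
  (FourTermDefectUpperCoprimeX9 AnalyticMuZeroX9 TwistedAnalyticMuZeroCoprimeX9 PublishedInputsX9
    AssemblyViaUpperCoprime)

namespace Summit.BirchSwinnertonDyer.BirchSwinnertonDyer.Rank1Residual

namespace SignedBalanceCoprime

/-- **The glue `AssemblyViaUpperCoprime`, proved.** As for `AssemblyViaUpper`: BCS (a) data at the four
curves, the sign lemma `k_i ≥ 0` (×4), the one-sided inequality at the COPRIME frame supplied by the
twisted crux (its class-number clause is handed to the upper inequality), `omega`. -/
theorem signedBalanceX9_assemblyViaUpperCoprime : AssemblyViaUpperCoprime := by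
  intro hUp hMu hTw hPub W _ _ p _ κ γ N _ f hX9 hκ hγ hγ' hf D
  obtain ⟨hBCSa, -, -, -, -, -, -, -⟩ := hPub
  obtain ⟨hX, g, k, hchar, hιg⟩ :=
    hBCSa W p κ γ f hX9.2.1 hX9.2.2.1 hX9.2.2.2.1 hX9.2.2.2.2.1 hκ hγ hγ' hf D
  suffices hk : k = 0 by
    subst hk
    exact ⟨hX, g, hchar, by simpa using hιg⟩
  have hk0 : 0 ≤ k := SignedBalance.defect_nonneg_of_unit_coeff (hMu W p f hX9 hf) hιg
  obtain ⟨dK, dF, hadm, hcop, hUK, hUF, hUKF⟩ := hTw W p hX9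
  have hpK : ¬ (p : ℤ) ∣ dK := hadm.2.2.1.1
  have hpF : ¬ (p : ℤ) ∣ dF := hadm.2.2.2.2.1.1
  have hsqK : Squarefree dK := hadm.1.2.1
  have hsqF : Squarefree dF := hadm.2.2.2.1.2.1
  have hsqKF : Squarefree (dK * dF) :=
    SignedBalance.squarefree_mul_of_admissible hsqK hsqF fun ℓ hℓ hℓF => (hadm.2.2.2.2.2.1 ℓ hℓ hℓF).1
  have hpKF : ¬ (p : ℤ) ∣ dK * dF := by
    intro h
    rcases (Nat.prime_iff_prime_int.mp (Fact.out : p.Prime)).dvd_mul.mp h with h | h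
    · exact hpK h
    · exact hpF h
  obtain ⟨W₁, i₁, i₁', hC₁, hX9₁, N₁, iN₁, f₁, hf₁, hn₁⟩ := SignedBalance.twist_data hX9 hsqK hpK hUK
  obtain ⟨W₂, i₂, i₂', hC₂, hX9₂, N₂, iN₂, f₂, hf₂, hn₂⟩ := SignedBalance.twist_data hX9 hsqF hpF hUF
  obtain ⟨W₃, i₃, i₃', hC₃, hX9₃, N₃, iN₃, f₃, hf₃, hn₃⟩ := SignedBalance.twist_data hX9 hsqKF hpKF hUKF
  haveI := i₁; haveI := i₁'; haveI := iN₁; haveI := i₂; haveI := i₂'; haveI := iN₂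
  haveI := i₃; haveI := i₃'; haveI := iN₃
  obtain ⟨D₁⟩ := W₁.nonempty_selmerDualData_holds κ γ hγ
  obtain ⟨D₂⟩ := W₂.nonempty_selmerDualData_holds κ γ hγ
  obtain ⟨D₃⟩ := W₃.nonempty_selmerDualData_holds κ γ hγ
  obtain ⟨-, g₁, k₁, hchar₁, hιg₁⟩ :=
    hBCSa W₁ p κ γ f₁ hX9₁.2.1 hX9₁.2.2.1 hX9₁.2.2.2.1 hX9₁.2.2.2.2.1 hκ hγ hγ' hf₁ D₁
  obtain ⟨-, g₂, k₂, hchar₂, hιg₂⟩ :=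
    hBCSa W₂ p κ γ f₂ hX9₂.2.1 hX9₂.2.2.1 hX9₂.2.2.2.1 hX9₂.2.2.2.2.1 hκ hγ hγ' hf₂ D₂
  obtain ⟨-, g₃, k₃, hchar₃, hιg₃⟩ :=
    hBCSa W₃ p κ γ f₃ hX9₃.2.1 hX9₃.2.2.1 hX9₃.2.2.2.1 hX9₃.2.2.2.2.1 hκ hγ hγ' hf₃ D₃
  have hk1 : 0 ≤ k₁ := SignedBalance.defect_nonneg_of_unit_coeff hn₁ hιg₁
  have hk2 : 0 ≤ k₂ := SignedBalance.defect_nonneg_of_unit_coeff hn₂ hιg₂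
  have hk3 : 0 ≤ k₃ := SignedBalance.defect_nonneg_of_unit_coeff hn₃ hιg₃
  have hsum : k + k₁ + k₂ + k₃ ≤ 0 :=
    hUp W p dK dF hX9 hadm hcop W₁ W₂ W₃ hC₁ hC₂ hC₃ κ γ f f₁ f₂ f₃ hκ hγ hγ' hf hf₁ hf₂ hf₃ D D₁ D₂ D₃
      k k₁ k₂ k₃ ⟨g, hchar, hιg⟩ ⟨g₁, hchar₁, hιg₁⟩ ⟨g₂, hchar₂, hιg₂⟩ ⟨g₃, hchar₃, hιg₃⟩
  omega

/-- The route item, by its fully qualified name. -/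
theorem assemblyViaUpperCoprime_holds :
    Summit.BirchSwinnertonDyer.BirchSwinnertonDyer.Theses.SignedBalanceX9.AssemblyViaUpperCoprime :=
  signedBalanceX9_assemblyViaUpperCoprime

end SignedBalanceCoprime

end Summit.BirchSwinnertonDyer.BirchSwinnertonDyer.Rank1Residual

end
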